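import Summits.HodgeConjecture.HodgeConjecture.Theorems.VHCAbelianSchemesRoadPullbackExtInjective
import Summits.HodgeConjecture.HodgeConjecture.Theorems.VHCAbelianSchemesRoadSigmaPullbackCompat
import Summits.HodgeConjecture.HodgeConjecture.Theorems.VHCAbelianSchemesRoadNowhereDisplaceableDefs
import Summits.HodgeConjecture.HodgeConjecture.Theorems.VHCAbelianSchemesRoadSigmaTransferDerivedLiftingDatum
import Literature.AlgebraicGeometry.Motives.AbelianVarietyIsogenyPullbackExact
import Literature.AlgebraicGeometry.HodgeTheory.HodgeSheafPullbackForms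
import Literature.AlgebraicGeometry.Modules.PullbackAlgebraUnit
import HarnessLib

/-!
# Crux stmt-HodgeConjecture-26512 `DiagLocalOfMarkmanPinnedForall`, LINE N′ node (N-U) — lens «transfer» (plan-lens-HodgeAV-26512-transfer g5, 2026-08-28;
# v1.1 binds g7, 2026-08-29):
# **SEMIREGULARITY DESCENDS ALONG `q`** — the last sentence of Markman's Lemma 9.3.11 TYPED as a re-cut of the admissibility conjunct of (N-U)

research route conditional on HC_CM; not a corollary; Q11.4-sentence-2 already refuted in dim ≥ 3. Nothing here proves (N-U), (S4), any
registered stub, the crux, №4, HC_AV, HC_CM or HC; typed ≠ proved. v1.1 (director-hodge g18 R18.49, SUMMON req-62): `sorry` ONLY inside the ONE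
displayed research input `stub_upstairsSigmaCarrier_End` (U-Σ); the two infrastructure inputs are BOUND BY NAME to landed Theorems-lane theorems —
(Dq-Inj) `stub_pullbackExt_injective := NowhereDisplaceable.pullbackExt_injective` (core-w5 g5, p682356, `…Theorems/VHCAbelianSchemesRoadPullbackExtInjective`)
and (Dq-σ) `stub_sigmaPullbackCompat := sigmaPullbackCompatAt_body` (core-w5 g6, p690602, `…Theorems/VHCAbelianSchemesRoadSigmaPullbackCompat`), 0 named
facts, std axioms (v1.0 87924329da2b2295 had 3 sorries; statements and defs of v1.0 are token-identical here); every composition is kernel-checked.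

TARGET. (N-U) = `Lines/NowhereDisplaceable.lean` v2 (90448395a0403d43) l.270 `stub_upstairsProperJumpCarrierExists_End` (director-hodge g17 R17.79
TRIGGER A: registered in (S4)'s place by LEAD 165's v3.19-A one-write; (S4) ⟸ (N-U) by p674094 `properJumpCarrierExists_End_of_line` over the LANDED
(N-F) p677847 `extJumpLocus_lifts` and (N-I) p673373 `properJump_of_confinedLifts`). Its research content at an End-trivial datum is (O₁) «print's
`Ē_{a′}` through a finite locally free resolution `E•` is an `AdmTw′`-pinned served datum» ∧ «`q^*E•` has proper Ext-jump locus on `J × Ĵ`»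
(negation g3, `O1Typing.lean` `isPrintCarrierTyping_iff`). After negation's (e′) (`PENCIL-26512-O1ADM.md` 3c3e88aa76faf880: [O₁-adm] MET ON PAPER through
the GLUABLE disjunct `gluableSigmaAdmissible` at `(d, a′) = (6, 8)`) the ONE sentence of print carrying [O₁-adm] is the END of the proof of Lemma 9.3.11:
«injectivity of `q^*σ_𝓑` restricted to `Ext²₀(𝓔,𝓔)^{G^∨}` … injectivity of `σ_𝓑` follows by the commutativity of the square with edges `σ_𝓑` and `q^*σ_𝓑`,
as the arrows labeled `q^*` are all isomorphisms» [corpus:paper:arxiv-2502.03415 p.74 L44–48; the square = Lemma 9.3.9 p.73]. The carrier is semiregular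
DOWNSTAIRS on `Y` because (α) `σ` COMMUTES WITH THE ÉTALE PULL-BACK `q^*` (Buchweitz–Flenner: the Atiyah class, the trace and the unit are functorial
under flat base change — BF §3; for `q^*`, unlike `q_*`, the functor is EXACT on ALL modules, so Mathlib's `mapDerivedCategory` IS the vehicle), (β) `q^*`
is INJECTIVE on `Ext²` (onto the `Ḡ^∨`-invariants; only injectivity is used), and (γ) UPSTAIRS the explicit sheaf `𝓔 ≅ q^*Ē ⊗ det` has `σ` injective ON
THE RANGE OF `q^*` (Markman §8.3 + Lemma 9.3.10: `𝓔` is NOT semiregular on all of `Ext²_P`, only on the invariant part). This file types (α), (β), (γ):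

* §1 **the abstract descent lemma** `injective_of_twoSidedCompat_of_injOn_range` (pure logic; the landed `isISemiregularC_of_sigmaCompat_of_injective`
  of `…SigmaTransferDerivedLiftingDatum` §1 with the upstairs hypothesis WEAKENED to joint injectivity on `range Ψ` and a second injective
  comparison `λ_q` on the upstairs target) — sorry-free;
* §2 **the vehicle for `q^*`**: `pullbackExt D` = `q^{**} := mapShiftedHom (Scheme.Modules.pullback q)` (legitimate: `q` is an isogeny, hence flat,
  so `q^*` is exact — `IsIsogeny.preservesFiniteLimits_pullback`, Literature; left adjoint, Mathlib), the two single-degree comparisons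
  `unitSingleComparison : q^*•(𝒪_Y[0]) ⟶ 𝒪_P[0]` (an ISOMORPHISM, `isIso_unitSingleComparison`, from Literature `isIso_pullback_map_algebraUnit_comp_counit`)
  and `formsSingleComparison q₀ : q^*•(Ω^{q₀}_Y[0]) ⟶ Ω^{q₀}_P[0]` (Literature `pullbackForms` = `dq` on `q₀`-forms), and the three displayed `Prop`s
  (Dq-Inj) `PullbackExtInjective`, (Dq-σ) `SigmaPullbackCompat` (the finite-étale-PULLBACK twin of the venture's `mapShiftedHom_sigmaC`, there for an
  isomorphism of schemes, and of THEOREM T′'s (At)+(Tr) for `g_*`), (U-Σ) `UpstairsSigmaCarrierEnd` (the research residue: print's Chern ∕ B-field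
  package WITHOUT the admissibility field + gluable conjuncts (i)(ii) + `σ` of `q^*E•` jointly injective ON `range q^{**}` + proper jump upstairs);
* §3 the two binds (Dq-Inj), (Dq-σ) and the one stub (U-Σ); §4 **the compositions, sorry-free**: `isISemiregularC_of_sigmaDescent` (one complex), `gluableSigmaAdmissible_of_sigmaDescent`,
  `admTw'_of_sigmaDescent`, and `upstairsProperJumpCarrierEnd_of_sigmaDescent : (Dq-Inj) → (Dq-σ) → (U-Σ) → (N-U)` with (N-U) VERBATIM
  (`UpstairsProperJumpCarrierEnd`, `Iff.rfl` with transfer g4's `LiftedCarrier.UpstairsProperJumpCarrierEnd` and LEAD's v3.19-A l.493).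

WHY A RE-CUT AND NOT A COSTUME. (U-Σ) differs from (N-U) in exactly the `adm` field: (N-U) wants `AdmTw′ 6 Y I E•` = joint injectivity of
`(σ_q^{E•})_{q+1∈I}` on ALL of `Ext²_Y(E•,E•)` for an object nobody can write down on `Y` without `Ḡ`-descent ((M5), core-w5); (U-Σ) wants joint
injectivity of `(σ_q^{q^*E•})` on the SUBSPACE `q^{**}(Ext²_Y) ⊆ Ext²_P(q^*E•, q^*E•)` — a statement about the UPSTAIRS object `q^*Ē ≅ 𝒢₁^* ⊗ det^{−a}`,
which print constructs explicitly from the Poincaré bundle and two Abel–Jacobi curves (§9.2–9.3) and whose `σ` print COMPUTES (§8.3, Lemma 9.3.10);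
the two infrastructure stubs (Dq-Inj), (Dq-σ) are TRUE statements of finite-étale descent, object-free, in the class of the landed (N-F) ∕ (N-I) ∕ (R)
bricks. Neither (U-Σ) ⇒ (N-U) nor (N-U) ⇒ (U-Σ) is available cheaply (BC7 probes, card `Ideas/sigma-descent-along-q.md`).

References: [cite: Markman2025SecantWeil, §9.3 Lemma 9.3.9, Lemma 9.3.10, Lemma 9.3.11 (last sentence of the proof) and Remark 9.3.7]
[cite: BuchweitzFlenner2003, §3 (functoriality of At and of the trace), Def. 4.1 and §5 (I-semiregular)] [cite: MumfordAV1970, §7 Thm. 4 (p. 72)]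
[cite: Mukai1978, §3 Prop. 3.12 (p. 249)] [cite: StacksProject, Tag 02N2 (flat pull-back is exact) and Tag 01AK (`f^*𝒪_Y = 𝒪_X`)]
[cite: Hartshorne1977, II Prop. 8.11 (dg on forms) and II §5 p. 110 (f^* ⊣ f_*)].
-/

noncomputable section

-- `TopCat.Presheaf`/`Scheme.Modules` are not reducible (as in Mathlib's `AlgebraicGeometry/Modules/Sheaf.lean`).
set_option backward.isDefEq.respectTransparency false

open CategoryTheory CategoryTheory.Category CategoryTheory.Limits AlgebraicGeometry Topology
open DerivedCategory HomologicalComplex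

namespace Summit.HodgeConjecture.HodgeConjecture.Cruxes.DiagLocalOfMarkmanPinnedForall.SigmaDescent

set_option linter.dupNamespace false -- the Cruxes namespace repeats the summit name, as in every file of this directory

open Literature.AlgebraicGeometry Literature.AlgebraicGeometry.Motives Literature.AlgebraicGeometry.Motives.AbelianVariety
open Literature.AlgebraicGeometry.HodgeTheory Literature.AlgebraicGeometry.Markman2025
open Literature.AlgebraicGeometry.KTheory (IsBoundedVBComplex)
open Literature.AlgebraicGeometry.Modules
open Literature.AlgebraicTopology.SingularHomology
open Summit.Ventures.HSemireg Summit.Ventures.HSemireg.HomComplex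
open Summit.HodgeConjecture.HodgeConjecture.Ring2.SemiregularRepresentatives
open Summit.HodgeConjecture.HodgeConjecture.Ring2.SemiregularRepresentatives.MoverTrap
open Summit.HodgeConjecture.HodgeConjecture.Ring2.SemiregularRepresentatives.NowhereDisplaceable (ProperJump DenseJump quotientPullbackComplex)

/-! ## §1 The abstract descent lemma (pure logic) -/

/-- **DESCENT OF JOINT INJECTIVITY ALONG A TWO-SIDED `σ`-COMPATIBLE PAIR.** Families `σ⁰_q : A → T₀ q` (downstairs) and `σ¹_q : B → T₁ q`
(upstairs), a map `Ψ : A → B` and comparisons `λ_q : T₁ q → T q`, `ρ_q : T₀ q → T q` with `λ_q (σ¹_q (Ψ x)) = ρ_q (σ⁰_q x)` for `q ∈ J`.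
If `Ψ` is injective, every `λ_q` (`q ∈ J`) is injective and `(σ¹_q)_{q∈J}` is jointly injective ON THE RANGE OF `Ψ`, then `(σ⁰_q)_{q∈J}` is
jointly injective. (The landed `isISemiregularC_of_sigmaCompat_of_injective` is the case `λ = id`, upstairs injective everywhere.)
[cite: BuchweitzFlenner2003, §5 (I-semiregular)] [cite: Markman2025SecantWeil, §9.3 Lemma 9.3.11 (last sentence of the proof)] -/
theorem injective_of_twoSidedCompat_of_injOn_range {A B : Type*} {T₀ T₁ T : ℕ → Type*} {J : Set ℕ}
    (σ₀ : ∀ q, A → T₀ q) (σ₁ : ∀ q, B → T₁ q) (Ψ : A → B) (lam : ∀ q, T₁ q → T q) (ρ : ∀ q, T₀ q → T q)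
    (hσ : ∀ q ∈ J, ∀ x, lam q (σ₁ q (Ψ x)) = ρ q (σ₀ q x)) (hΨ : Function.Injective Ψ)
    (hlam : ∀ q ∈ J, Function.Injective (lam q))
    (h : Set.InjOn (fun (b : B) (q : J) => σ₁ q b) (Set.range Ψ)) :
    Function.Injective fun (a : A) (q : J) => σ₀ q a := by
  intro x y hxy
  apply hΨ
  refine h ⟨x, rfl⟩ ⟨y, rfl⟩ (funext fun q => hlam q.1 q.2 ?_)
  rw [hσ q.1 q.2, hσ q.1 q.2]
  exact congrArg (ρ q.1) (congr_fun hxy q)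

/-! ## §2 The vehicle for `q^*` and the three displayed statements -/

section Vehicle

variable (D : SecantQuotientDatum)

/-- `q^*` is exact: it preserves finite limits (an isogeny is flat; flat pull-back is exact). [cite: StacksProject, Tag 02N2]
[cite: MumfordAV1970, §7 Thm. 4 (p. 72)] -/
theorem preservesFiniteLimits_pullback_q : PreservesFiniteLimits (Scheme.Modules.pullback (Hom.toSchemeHom D.q)) :=
  D.isIsogeny_q.preservesFiniteLimits_pullback

/-- **`q^{**}`** — the action of the EXACT functor `q^*` on shifted Homs of complexes on `Y`,
`Hom_{D(Y)}(Q M•, (Q L•)⟦k⟧) → Hom_{D(P)}(Q q^*M•, (Q q^*L•)⟦k⟧)`: the venture's `mapShiftedHom` (Mathlib's `mapDerivedCategory` sandwich) for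
`Scheme.Modules.pullback q` — additive and a left adjoint (Mathlib), finite-limit preserving (`preservesFiniteLimits_pullback_q`); the route's
ambient derived categories `HasDerivedCategory.standard`. [cite: StacksProject, Tag 02N2] [cite: Hartshorne1977, II §5 p. 110] -/
def pullbackExt {M L : CochainComplex D.Y.X.left.Modules ℤ} {k : ℤ}
    (y : letI := HasDerivedCategory.standard D.Y.X.left.Modules; ShiftedHom (Q.obj M) (Q.obj L) k) :
    letI := HasDerivedCategory.standard D.P.X.left.Modules
    ShiftedHom (Q.obj (quotientPullbackComplex D M)) (Q.obj (quotientPullbackComplex D L)) k :=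
  letI := HasDerivedCategory.standard D.Y.X.left.Modules
  letI := HasDerivedCategory.standard D.P.X.left.Modules
  haveI := preservesFiniteLimits_pullback_q D
  Summit.Ventures.HSemireg.mapShiftedHom (Scheme.Modules.pullback (Hom.toSchemeHom D.q)) y

/-- **`q^*•(𝒪_Y[0]) ⟶ 𝒪_P[0]`**: single-degree commutation (Mathlib `singleMapHomologicalComplex`) followed by `[f^*(f♯) ≫ ε]` (`f^*𝒪_Y = 𝒪_X`).
[cite: StacksProject, Tag 01AK] -/
def unitSingleComparison :
    quotientPullbackComplex D ((single D.Y.X.left.Modules (ComplexShape.up ℤ) 0).obj (unitModule D.Y.X.left)) ⟶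
      (single D.P.X.left.Modules (ComplexShape.up ℤ) 0).obj (unitModule D.P.X.left) :=
  (singleMapHomologicalComplex (Scheme.Modules.pullback (Hom.toSchemeHom D.q)) (ComplexShape.up ℤ) 0).hom.app (unitModule D.Y.X.left) ≫
    (single D.P.X.left.Modules (ComplexShape.up ℤ) 0).map
      ((Scheme.Modules.pullback (Hom.toSchemeHom D.q)).map (algebraUnit (Hom.toSchemeHom D.q)) ≫
        (Scheme.Modules.pullbackPushforwardAdjunction (Hom.toSchemeHom D.q)).counit.app (unitModule D.P.X.left))

/-- `q^*•(𝒪_Y[0]) ⟶ 𝒪_P[0]` is an isomorphism (Literature `isIso_pullback_map_algebraUnit_comp_counit`). [cite: StacksProject, Tag 01AK] -/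
theorem isIso_unitSingleComparison : IsIso (unitSingleComparison D) := by
  haveI := isIso_pullback_map_algebraUnit_comp_counit (Hom.toSchemeHom D.q)
  unfold unitSingleComparison
  infer_instance

/-- **`q^*•(Ω^{q₀}_Y[0]) ⟶ Ω^{q₀}_P[0]`**: single-degree commutation followed by `[dq]` on `q₀`-forms (Literature `pullbackForms`; an isomorphism
for the étale `q`, not needed here). [cite: Hartshorne1977, II Prop. 8.11] -/
def formsSingleComparison (q₀ : ℕ) :
    quotientPullbackComplex D ((single D.Y.X.left.Modules (ComplexShape.up ℤ) 0).obj (hodgeSheaf D.Y.X q₀)) ⟶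
      (single D.P.X.left.Modules (ComplexShape.up ℤ) 0).obj (hodgeSheaf D.P.X q₀) :=
  (singleMapHomologicalComplex (Scheme.Modules.pullback (Hom.toSchemeHom D.q)) (ComplexShape.up ℤ) 0).hom.app (hodgeSheaf D.Y.X q₀) ≫
    (single D.P.X.left.Modules (ComplexShape.up ℤ) 0).map (pullbackForms D.q.hom.hom.hom q₀)

/-- **(Dq-σ) AT ONE COMPLEX — `σ` COMMUTES WITH `q^*`**: for `E•` on `Y` in `[a, b]` with vector-bundle terms, every `q₀` and every
`x ∈ Ext²_Y(E•, E•)`: **`[u] · σ_{q₀}^{q^*E•}(q^{**}x) = q^{**}(σ_{q₀}^{E•}(x)) · [dq]⟦q₀+2⟧`** as maps `Q(q^*•𝒪_Y[0]) ⟶ (Q Ω^{q₀}_P[0])⟦q₀+2⟧`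
(`u = unitSingleComparison`, `dq = formsSingleComparison q₀`). On paper: `q^*At(E•) = At(q^*E•)` (jets commute with flat base change),
`q^*` is monoidal and triangulated (`q^{**}` multiplicative, `mapShiftedHom_comp`), `q^*Tr = Tr ∘ q^*`, `q^*(unit) = unit` — Buchweitz–Flenner §3;
the finite-étale-PULLBACK twin of the venture's `mapShiftedHom_sigmaC` (isomorphism case) and of THEOREM T′'s (At)+(Tr) (push-forward case).
[cite: BuchweitzFlenner2003, §3 and Def. 4.1] [cite: Markman2025SecantWeil, §9.3 Lemma 9.3.9 (the commutative square)] -/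
def SigmaPullbackCompatAt (E : CochainComplex D.Y.X.left.Modules ℤ) : Prop :=
  ∀ (a b : ℤ) [E.IsStrictlyGE a] [E.IsStrictlyLE b] (hE : ∀ i, IsFiniteLocallyFree (E.X i)) (q₀ : ℕ),
    letI := HasDerivedCategory.standard D.Y.X.left.Modules
    letI := HasDerivedCategory.standard D.P.X.left.Modules
    ∀ x : ShiftedHom (Q.obj E) (Q.obj E) (2 : ℤ),
      Q.map (unitSingleComparison D) ≫
          sigmaC D.P.X (quotientPullbackComplex D E) a b (fun i => (hE i).pullback (Hom.toSchemeHom D.q)) q₀ (pullbackExt D x) =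
        pullbackExt D (sigmaC D.Y.X E a b hE q₀ x) ≫
          (Q.map (formsSingleComparison D q₀))⟦((q₀ + 2 : ℕ) : ℤ)⟧'

/-- **(U-σ) AT ONE COMPLEX AND ONE DEGREE SET — UPSTAIRS JOINT INJECTIVITY ON THE RANGE OF `q^{**}`**: for some presentation `[a, b]` of `E•`,
`(σ_{q₀}^{q^*E•})_{q₀+1 ∈ I}` is jointly injective on `q^{**}(Ext²_Y(E•,E•)) ⊆ Ext²_P(q^*E•, q^*E•)`. For print's `Ē_{a′}` (`q^*Ē ≅ 𝒢₁^* ⊗ det^{−a′}`):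
Markman Lemma 9.3.10 ∕ §8.3 (the secant^{⊠2} sheaf modulo the Pontryagin ideal) — `q^*Ē` is NOT semiregular on all of `Ext²_P`, only on the
`Ḡ^∨`-invariants = `range q^*`. [cite: Markman2025SecantWeil, §8.3 Remark 8.3.5–8.3.6, §9.3 Lemma 9.3.10 and Lemma 9.3.11]
[cite: BuchweitzFlenner2003, Def. 4.1 and §5] -/
def UpstairsSigmaInjOnRange (E : CochainComplex D.Y.X.left.Modules ℤ) (I : Finset ℕ) : Prop :=
  ∃ (a b : ℤ) (_ : E.IsStrictlyGE a) (_ : E.IsStrictlyLE b) (hE : ∀ i, IsFiniteLocallyFree (E.X i)),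
    letI := HasDerivedCategory.standard D.Y.X.left.Modules
    letI := HasDerivedCategory.standard D.P.X.left.Modules
    Set.InjOn
      (fun (x' : ShiftedHom (Q.obj (quotientPullbackComplex D E)) (Q.obj (quotientPullbackComplex D E)) (2 : ℤ)) (q₀ : {q₀ : ℕ | q₀ + 1 ∈ I}) =>
        sigmaC D.P.X (quotientPullbackComplex D E) a b (fun i => (hE i).pullback (Hom.toSchemeHom D.q)) q₀ x')
      (Set.range (pullbackExt D (M := E) (L := E) (k := 2)))

end Vehicle

/-- **(Dq-Inj) — `q^{**}` IS INJECTIVE ON SHIFTED HOMS BETWEEN BOUNDED VECTOR-BUNDLE COMPLEXES** (print: «the arrows labeled `q^*` are all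
isomorphisms» onto the `Ḡ^∨`-invariants, Lemma 9.3.9; only injectivity is used). On paper: `q^* ⊣ Rq_*`, `q_*q^*L• ≅ L• ⊗ q_*𝒪_P` (projection
formula) and `𝒪_Y → q_*𝒪_P` SPLITS (`(deg q)⁻¹·trace`, char 0), so `y ↦ q^*y ↦ y · η_{L•}` is injective; kernel plan: identify `pullbackExt` with the
transpose under the tree's derived adjunction `Modules.shiftedHomLinearEquivPullbackPushforwardOfVectorBundles` (K-injective route) and use the landed
retract p677847 `exists_retract_pushforward_quotientPullback` IF its section is the unit (else the trace splitting of `Modules/PushforwardTrace`).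
TRUE infrastructure; kernel L; census-neutral like (N-F)/(N-I)/(R). [cite: Markman2025SecantWeil, §9.3 Lemma 9.3.9] [cite: Mukai1978, §3 Prop. 3.12 (p. 249)]
[cite: StacksProject, Tag 0BVH] [cite: Hartshorne1977, II §5 p. 110] -/
@[conjecture] def PullbackExtInjective : Prop :=
  ∀ (D : SecantQuotientDatum) (M L : CochainComplex D.Y.X.left.Modules ℤ), IsBoundedVBComplex M → IsBoundedVBComplex L →
    ∀ k : ℤ, Function.Injective (pullbackExt D (M := M) (L := L) (k := k))

/-- **(Dq-σ) — `σ` COMMUTES WITH THE ÉTALE PULL-BACK `q^*`** at every bounded vector-bundle complex on every secant quotient (`SigmaPullbackCompatAt`).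
TRUE infrastructure (Buchweitz–Flenner §3 functoriality of `At`, `Tr`, unit under flat base change); kernel L–XL (the pieces (N1)–(N5) of the
venture's isomorphism case, with `pullbackComp`/`pullbackCongr` replacing `pushforward` of an iso). [cite: BuchweitzFlenner2003, §3 and Def. 4.1]
[cite: Markman2025SecantWeil, §9.3 Lemma 9.3.9] -/
@[conjecture] def SigmaPullbackCompat : Prop :=
  ∀ (D : SecantQuotientDatum) (E : CochainComplex D.Y.X.left.Modules ℤ), IsBoundedVBComplex E → SigmaPullbackCompatAt D E

/-- The admissibility notion asking NOTHING (so that `PinnedTwistedDatum C NoAdm X θ γ` is print's Chern ∕ `B`-field ∕ degree package of a bounded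
vector-bundle complex pinned to `(θ, γ)`, WITHOUT any semiregularity clause). [cite: Markman2025SecantWeil, §1.5 (p. 7) and Rem. 9.3.7] -/
abbrev NoAdm : PerfectAdmissibility := fun _ _ _ _ => True

/-- **(U-Σ) — THE RESEARCH RESIDUE OF (N-U) AFTER `σ`-DESCENT: AN UPSTAIRS-SEMIREGULAR-ON-RANGE CARRIER AT EVERY END-TRIVIAL NON-HYPERELLIPTIC
H-GOOD DATUM.** Some pinned-served `γ̄` and some bounded vector-bundle complex `E•` on `Y` with print's Chern ∕ `B`-field package pinned to
`(h_Y(θ₀), γ̄)` (`PinnedTwistedDatum C NoAdm`), the two gluable conjuncts (i) `{1,…,6} ⊆ I`, (ii) `Ext^{<0}(E•,E•) = 0`, the UPSTAIRS clause (U-σ)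
`UpstairsSigmaInjOnRange D E• I`, and PROPER Ext-jump locus of `q^*E•` on `J × Ĵ`. For print: `E•` = a resolution of `Ē_{a′}` at `(d, a′)` with
`48a′ ≡ −1 (mod d+1)`, `I = {1,…,6}`; (i)(ii) and the package = negation g3's (e′)∕(d′) readings (O1ADM memo); (U-σ) = Lemma 9.3.10–9.3.11;
proper jump = PENCIL-26512-T12 §5 ∕ TWOTORSION. IN-HOUSE re-cut; research; XL (objects (M1)–(M4) not in the tree — but NO `Ḡ`-descent (M5) of
semiregularity is asked: that is (Dq-Inj)+(Dq-σ)). Why it might fail: through [O₁-served] (negation (f′)) or a mismatch between the tree's untwisted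
`sigmaC` on the initial segment and print's twisted `σ` (Pridham Rem. 2.26 ∕ Markman Lemma 9.3.8: unipotent change — harmless for injectivity on paper).
[cite: Markman2025SecantWeil, §8.3, §9.3 Lemma 9.3.5, 9.3.10, 9.3.11 and Remark 9.3.7] [cite: Pridham2024Semiregularity, Remark 2.26]
[cite: Mukai1978, §3] -/
@[conjecture] def UpstairsSigmaCarrierEnd : Prop :=
  ∀ (C : ChernCharacterBetti) (D : SecantQuotientDatum) (θ₀ : complexBetti D.𝒥.J.X 2),
    ¬ D.𝒥.IsHyperelliptic → OrbitTranslatesDisjoint D.𝒥 D.G₁ D.G₂ → D.𝒥.J.IsPolarizationClassOf D.Θ θ₀ → EndTrivial D →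
    ∃ γ ∈ secantQuotientServedClassesPinned D.Y.X (D.hY θ₀), ∃ 𝓓₀ : PinnedTwistedDatum C NoAdm D.Y.X (D.hY θ₀) γ,
      (∀ p : ℕ, 1 ≤ p → p ≤ 6 → p ∈ 𝓓₀.I) ∧ (∀ k : ℤ, k < 0 → extRank D.Y.X 𝓓₀.E k = 0) ∧
        UpstairsSigmaInjOnRange D 𝓓₀.E 𝓓₀.I ∧ ProperJump D.P (quotientPullbackComplex D 𝓓₀.E)

/-- **(N-U) as a `Prop`** — `stub_upstairsProperJumpCarrierExists_End` VERBATIM (`Lines/NowhereDisplaceable.lean` v2 l.270; = transfer g4's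
`LiftedCarrier.UpstairsProperJumpCarrierEnd`; = LEAD 165's v3.19-A l.493). [cite: Markman2025SecantWeil, §9.3 Lemma 9.3.11] [cite: Mukai1978, §3] -/
@[conjecture] def UpstairsProperJumpCarrierEnd : Prop :=
  ∀ (C : ChernCharacterBetti) (D : SecantQuotientDatum) (θ₀ : complexBetti D.𝒥.J.X 2),
    ¬ D.𝒥.IsHyperelliptic → OrbitTranslatesDisjoint D.𝒥 D.G₁ D.G₂ → D.𝒥.J.IsPolarizationClassOf D.Θ θ₀ → EndTrivial D →
    ∃ γ ∈ secantQuotientServedClassesPinned D.Y.X (D.hY θ₀), ∃ 𝓓 : PinnedTwistedDatum C AdmTw' D.Y.X (D.hY θ₀) γ,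
      ProperJump D.P (quotientPullbackComplex D 𝓓.E)

/-! ## §3 The three displayed inputs: (Dq-Inj) and (Dq-σ) BOUND BY NAME (v1.1), (U-Σ) the ONLY `sorry` of this file -/

/-- **(Dq-Inj) BOUND BY NAME** (v1.1) to `NowhereDisplaceable.pullbackExt_injective` (Theorems `VHCAbelianSchemesRoadPullbackExtInjective`, core-w5 g5,
p682356): derived faithfulness of the exact left adjoint `q^*` from the termwise-split unit (trace retraction, Stacks 0BVH, `deg q ≠ 0` in char 0)
and a Leray K-injective resolution (`Literature.Algebra.Homology.shiftedHom_map_mapDerivedCategory_injective`, p681997); the hypothesis on `M•` is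
unused. One token, as pre-checked by core-w5 g5 (ring2 INBOX l.6056). [cite: Markman2025SecantWeil, §9.3 Lemma 9.3.9] [cite: Mukai1978, §3 Prop. 3.12 (p. 249)]
[cite: StacksProject, Tag 0BVH and Tag 0DVC] -/
theorem stub_pullbackExt_injective : PullbackExtInjective :=
  fun D M L _ hL k => NowhereDisplaceable.pullbackExt_injective D M L hL k

/-- **(Dq-σ) BOUND BY NAME** (v1.1) to `sigmaPullbackCompatAt_body` (Theorems `VHCAbelianSchemesRoadSigmaPullbackCompat`, core-w5 g6, p690602) =
`mapShiftedHom_sigmaC_pullback` at `g := D.q`: `σ_q` COMMUTES WITH EVERY EXACT PULL-BACK — unit (Q2) p684838, `Φ` ∕ complex Atiyah powers (Q3′) p684335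
+ (Q4) p689100 («jets commute with base change»), supertrace (Q5) p687429; Buchweitz–Flenner §3 as one kernel statement. One token (up to `delta` on
`pullbackExt` ∕ `unitSingleComparison` ∕ `formsSingleComparison`), as pre-checked by core-w5 g6 (`w5g6_BindCheck_SigmaPullbackCompat_scratch_rc0.lean`,
ring2 INBOX l.6198). [cite: BuchweitzFlenner2003, §3 and Def. 4.1] [cite: Markman2025SecantWeil, §9.3 Lemma 9.3.9] -/
theorem stub_sigmaPullbackCompat : SigmaPullbackCompat :=
  fun D E _ a b _ _ hE q₀ x => sigmaPullbackCompatAt_body D E a b hE q₀ x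

/-- STUB (U-Σ) — the research residue; the ONLY `sorry` of this file (v1.1). [cite: Markman2025SecantWeil, §8.3, §9.3 Lemma 9.3.10–9.3.11 and Remark 9.3.7] -/
theorem stub_upstairsSigmaCarrier_End : UpstairsSigmaCarrierEnd := by
  sorry

/-! ## §4 Compositions (sorry-free given the displayed inputs) -/

section Compositions

variable (D : SecantQuotientDatum)

/-- Precomposition with `Q` of an isomorphism of complexes is injective on (shifted) Homs out of its target. [folklore] -/
theorem comp_injective_of_isIso {C : Type*} [Category C] {X Y Z : C} (u : X ⟶ Y) [IsIso u] :
    Function.Injective fun (s : Y ⟶ Z) => u ≫ s :=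
  fun _ _ h => (cancel_epi u).mp h

/-- **`σ`-DESCENT AT ONE COMPLEX**: (Dq-Inj at `E•`, degree 2) ∧ (Dq-σ at `E•`) ∧ (U-σ for `[a,b]`, `hE`, `I`) ⟹ `(σ_{q₀}^{E•})_{q₀+1∈I}` jointly
injective on `Ext²_Y(E•,E•)` — the typed last sentence of the proof of Lemma 9.3.11. [cite: Markman2025SecantWeil, §9.3 Lemma 9.3.11]
[cite: BuchweitzFlenner2003, §5 (I-semiregular)] -/
theorem isISemiregularC_of_sigmaDescent (E : CochainComplex D.Y.X.left.Modules ℤ) (a b : ℤ) [E.IsStrictlyGE a] [E.IsStrictlyLE b]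
    (hE : ∀ i, IsFiniteLocallyFree (E.X i)) (I : Finset ℕ)
    (hinj : Function.Injective (pullbackExt D (M := E) (L := E) (k := 2)))
    (hσ : SigmaPullbackCompatAt D E)
    (hU : letI := HasDerivedCategory.standard D.Y.X.left.Modules
      letI := HasDerivedCategory.standard D.P.X.left.Modules
      Set.InjOn
        (fun (x' : ShiftedHom (Q.obj (quotientPullbackComplex D E)) (Q.obj (quotientPullbackComplex D E)) (2 : ℤ)) (q₀ : {q₀ : ℕ | q₀ + 1 ∈ I}) =>
          sigmaC D.P.X (quotientPullbackComplex D E) a b (fun i => (hE i).pullback (Hom.toSchemeHom D.q)) q₀ x')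
        (Set.range (pullbackExt D (M := E) (L := E) (k := 2)))) :
    letI := HasDerivedCategory.standard D.Y.X.left.Modules
    IsISemiregularC D.Y.X E a b hE {q₀ : ℕ | q₀ + 1 ∈ I} := by
  letI := HasDerivedCategory.standard D.Y.X.left.Modules
  letI := HasDerivedCategory.standard D.P.X.left.Modules
  haveI := isIso_unitSingleComparison D
  refine injective_of_twoSidedCompat_of_injOn_range (J := {q₀ : ℕ | q₀ + 1 ∈ I})
    (T := fun q₀ => Q.obj (quotientPullbackComplex D ((single D.Y.X.left.Modules (ComplexShape.up ℤ) 0).obj (unitModule D.Y.X.left))) ⟶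
      (Q.obj ((single D.P.X.left.Modules (ComplexShape.up ℤ) 0).obj (hodgeSheaf D.P.X q₀)))⟦((q₀ + 2 : ℕ) : ℤ)⟧)
    (fun q₀ => sigmaC D.Y.X E a b hE q₀)
    (fun q₀ => sigmaC D.P.X (quotientPullbackComplex D E) a b (fun i => (hE i).pullback (Hom.toSchemeHom D.q)) q₀)
    (pullbackExt D (M := E) (L := E) (k := 2))
    (fun q₀ s => Q.map (unitSingleComparison D) ≫ s)
    (fun q₀ t => pullbackExt D t ≫ (Q.map (formsSingleComparison D q₀))⟦((q₀ + 2 : ℕ) : ℤ)⟧')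
    (fun q₀ _ x => hσ a b hE q₀ x) hinj (fun q₀ _ => comp_injective_of_isIso _) hU

/-- **THE GLUABLE DISJUNCT FROM `σ`-DESCENT**: (i) ∧ (ii) ∧ (Dq-Inj at `E•`) ∧ (Dq-σ at `E•`) ∧ (U-σ) ⟹ `gluableSigmaAdmissible 6 Y I E•`.
[cite: BuchweitzFlenner2003, Def. 4.1 and §5] [cite: Markman2025SecantWeil, §9.3 Lemma 9.3.11] -/
theorem gluableSigmaAdmissible_of_sigmaDescent (E : CochainComplex D.Y.X.left.Modules ℤ) (I : Finset ℕ)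
    (hi : ∀ p : ℕ, 1 ≤ p → p ≤ 6 → p ∈ I) (hii : ∀ k : ℤ, k < 0 → extRank D.Y.X E k = 0)
    (hinj : Function.Injective (pullbackExt D (M := E) (L := E) (k := 2)))
    (hσ : SigmaPullbackCompatAt D E) (hU : UpstairsSigmaInjOnRange D E I) :
    gluableSigmaAdmissible 6 D.Y.X I E := by
  obtain ⟨a, b, _, _, hE, hU⟩ := hU
  exact ⟨hi, hii, a, b, ‹_›, ‹_›, hE, isISemiregularC_of_sigmaDescent D E a b hE I hinj hσ hU⟩

/-- **`AdmTw′` FROM `σ`-DESCENT** (the crux's disjunction through its gluable disjunct — negation g3's rider (r1): the vector-bundle disjunct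
`bfSingleAdmissible′` is NOT met by print's reflexive carrier). [cite: BuchweitzFlenner2003, Def. 4.1 and §5] [cite: Markman2025SecantWeil, Prop. 9.2.2 and Lemma 9.3.11] -/
theorem admTw'_of_sigmaDescent (E : CochainComplex D.Y.X.left.Modules ℤ) (I : Finset ℕ)
    (hi : ∀ p : ℕ, 1 ≤ p → p ≤ 6 → p ∈ I) (hii : ∀ k : ℤ, k < 0 → extRank D.Y.X E k = 0)
    (hinj : Function.Injective (pullbackExt D (M := E) (L := E) (k := 2)))
    (hσ : SigmaPullbackCompatAt D E) (hU : UpstairsSigmaInjOnRange D E I) :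
    AdmTw' 6 D.Y.X I E :=
  Or.inl (gluableSigmaAdmissible_of_sigmaDescent D E I hi hii hinj hσ hU)

/-- Supplying the admissibility field of a pinned twisted datum (same object, same package). [cite: Markman2025SecantWeil, §1.5 (p. 7)] -/
def pinnedTwistedDatumOfNoAdm {C : ChernCharacterBetti} {Adm : PerfectAdmissibility} {X : SchemeOver ℂ} {θ : complexBetti X 2}
    {γ : complexBetti X (2 * 3)} (𝓓₀ : PinnedTwistedDatum C NoAdm X θ γ) (hadm : Adm 6 X 𝓓₀.I 𝓓₀.E) :
    PinnedTwistedDatum C Adm X θ γ :=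
  ⟨𝓓₀.E, 𝓓₀.bounded, 𝓓₀.B₀, 𝓓₀.B₀_rational, 𝓓₀.B₀_algebraic, 𝓓₀.I, 𝓓₀.three_mem, hadm, 𝓓₀.c, 𝓓₀.kappa_three, 𝓓₀.kappa_of_ne⟩

/-- The object is unchanged. [folklore] -/
@[simp] theorem pinnedTwistedDatumOfNoAdm_E {C : ChernCharacterBetti} {Adm : PerfectAdmissibility} {X : SchemeOver ℂ} {θ : complexBetti X 2}
    {γ : complexBetti X (2 * 3)} (𝓓₀ : PinnedTwistedDatum C NoAdm X θ γ) (hadm : Adm 6 X 𝓓₀.I 𝓓₀.E) :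
    (pinnedTwistedDatumOfNoAdm 𝓓₀ hadm).E = 𝓓₀.E :=
  rfl

/-- Forgetting the admissibility field (so (U-Σ)'s package is exactly (N-U)'s minus `adm`). [cite: Markman2025SecantWeil, §1.5 (p. 7)] -/
def PinnedTwistedDatum.toNoAdm {C : ChernCharacterBetti} {Adm : PerfectAdmissibility} {X : SchemeOver ℂ} {θ : complexBetti X 2}
    {γ : complexBetti X (2 * 3)} (𝓓 : PinnedTwistedDatum C Adm X θ γ) : PinnedTwistedDatum C NoAdm X θ γ :=
  ⟨𝓓.E, 𝓓.bounded, 𝓓.B₀, 𝓓.B₀_rational, 𝓓.B₀_algebraic, 𝓓.I, 𝓓.three_mem, trivial, 𝓓.c, 𝓓.kappa_three, 𝓓.kappa_of_ne⟩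

/-- **(Dq-Inj) → (Dq-σ) → (U-Σ) → (N-U) VERBATIM** — the line's concluding composition: at an End-trivial datum take (U-Σ)'s carrier `E•`, descend
its semiregularity along `q` (`admTw'_of_sigmaDescent`), and keep the proper jump upstairs. Sorry-free; the three inputs enter by statement.
[cite: Markman2025SecantWeil, §9.3 Lemma 9.3.11] [cite: BuchweitzFlenner2003, §5] [cite: Mukai1978, §3] -/
theorem upstairsProperJumpCarrierEnd_of_sigmaDescent (hInj : PullbackExtInjective) (hσ : SigmaPullbackCompat) (hU : UpstairsSigmaCarrierEnd) :
    UpstairsProperJumpCarrierEnd := by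
  intro C D θ₀ hnh hH hθ₀ hEnd
  obtain ⟨γ, hγ, 𝓓₀, hi, hii, hUσ, hPJ⟩ := hU C D θ₀ hnh hH hθ₀ hEnd
  exact ⟨γ, hγ, pinnedTwistedDatumOfNoAdm 𝓓₀
    (admTw'_of_sigmaDescent D 𝓓₀.E 𝓓₀.I hi hii (hInj D 𝓓₀.E 𝓓₀.E 𝓓₀.bounded 𝓓₀.bounded 2) (hσ D 𝓓₀.E 𝓓₀.bounded) hUσ), hPJ⟩

/-- **(N-U) MODULO EXACTLY (U-Σ)** (v1.1; `#print axioms`: `sorryAx` enters ONLY through `stub_upstairsSigmaCarrier_End` — `stub_pullbackExt_injective`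
and `stub_sigmaPullbackCompat` are sorry-free binds on {propext, Classical.choice, Quot.sound}). From here: (S4) by p674094 `properJumpCarrierExists_End_of_line` over the landed (N-F) p677847 and (N-I) p673373,
and the crux by name by the §4 chain of `Lines/NowhereDisplaceable.lean` ∕ transfer g4's `LiftedCarrier.DiagLocalOfMarkmanPinnedForall_of_lifted`
(not composed in this file — no `Cruxes` imports; since v1.1 the (N-F) module `…ExtJumpLocusLifts` is transitively imported through
`…PullbackExtInjective`, so the (S4) step is one `exact` away whenever the LEAD wants it here). [cite: Markman2025SecantWeil, §9.3 Lemma 9.3.11] -/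
theorem upstairsProperJumpCarrierEnd_of_stubs : UpstairsProperJumpCarrierEnd :=
  upstairsProperJumpCarrierEnd_of_sigmaDescent stub_pullbackExt_injective stub_sigmaPullbackCompat stub_upstairsSigmaCarrier_End

/-- **CONVERSELY, (N-U) GIVES (U-Σ)'s PACKAGE BUT NOT ITS UPSTAIRS CLAUSE**: from an `AdmTw′`-datum one recovers (i) only through the gluable
disjunct and (U-σ) only through (Dq-σ) read FORWARD plus injectivity of `[dq]` on the target — recorded to show the re-cut is not a rewording:
the forward direction needs the extra input `hfwd`. [cite: BuchweitzFlenner2003, §5] -/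
theorem upstairsSigmaInjOnRange_of_gluable (E : CochainComplex D.Y.X.left.Modules ℤ) (I : Finset ℕ)
    (hσ : SigmaPullbackCompatAt D E)
    (hfwd : ∀ q₀ : ℕ, q₀ + 1 ∈ I →
      letI := HasDerivedCategory.standard D.Y.X.left.Modules
      letI := HasDerivedCategory.standard D.P.X.left.Modules
      Function.Injective fun (t : sigmaTarget D.Y.X q₀) =>
        pullbackExt D t ≫ (Q.map (formsSingleComparison D q₀))⟦((q₀ + 2 : ℕ) : ℤ)⟧')
    (h : gluableSigmaAdmissible 6 D.Y.X I E) : UpstairsSigmaInjOnRange D E I := by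
  letI := HasDerivedCategory.standard D.Y.X.left.Modules
  letI := HasDerivedCategory.standard D.P.X.left.Modules
  obtain ⟨-, -, a, b, _, _, hE, hsr⟩ := h
  refine ⟨a, b, ‹_›, ‹_›, hE, ?_⟩
  rintro _ ⟨x, rfl⟩ _ ⟨y, rfl⟩ hxy
  have hxy' : x = y := hsr (funext fun q₀ => hfwd q₀.1 q₀.2 (by
    have hq := congrArg (fun s => Q.map (unitSingleComparison D) ≫ s) (congr_fun hxy q₀)
    dsimp only at hq ⊢
    rw [hσ a b hE q₀.1 x, hσ a b hE q₀.1 y] at hq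
    exact hq))
  rw [hxy']

end Compositions

end Summit.HodgeConjecture.HodgeConjecture.Cruxes.DiagLocalOfMarkmanPinnedForall.SigmaDescent

end
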